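import Literature.MathematicalPhysics.StatisticalMechanics.LocalMatchingCompactness

/-!
# Crux `PeriodicWindows` (stmt-AtomisticToContinuum-3240), line `Sketch` — stub `stub_goodLimit`, A

Per-window bookkeeping for the compactness step E0a (`stub_goodLimit`) of the lead skeleton
`PeriodicWindowsSketch`. ONE configuration `y : Fin N → ℝ³` carries a GOOD window about `y i₀` at
scale `(R, η)`: level heights `c : ℤ → ℝ` with gaps `≥ 19/25`, a normal `nrm`, a level index `l`,
`η`-flatness `|⟪y j - y i₀, nrm⟫ - c (l j)| ≤ η` on the window `dist (y j) (y i₀) ≤ R`, and on the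
half window the exact `6 + 3 + 3` neighbour count within distance `1` with `η`-sharp bond lengths
`a` (same level) and `b` (adjacent levels). We extract the `Nat.card`-free facts consumed by the
limit procedure (parts B, C and the assembly):

* `gl_level_gap`, `gl_level_gap_abs` — distinct levels are `≥ 19/25` apart;
* `gl_inner_sub_levels`, `gl_levels_dichotomy`, `gl_levels_dichotomy_or` — along `nrm` two window
  particles differ by the difference of their level heights up to `2η`, hence they are either
  `2η`-close or `≥ 19/25 - 2η` apart along `nrm`;
* `gl_sharp_of_inner_lt` — a neighbour (distance `≤ 1`) of a half-window particle closer than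
  `19/25 - 2η` along `nrm` is on the same level, so the bond is `η`-close to `a`;
* `gl_six_indices`, `gl_up_indices`, `gl_down_indices` — the `6` same-level, `3` upper and `3` lower
  neighbours of a half-window particle as an injective family `g : Fin K → Fin N` of window
  particles with bonds `η`-close to `a` (resp. `b`) and offsets along `nrm` that are `2η`-close to
  `σ * G` for a common `G ≥ 19/25` and `σ = 0` (resp. `1`, `-1`) — one shape for the three clauses.

Pure bookkeeping (triangle inequalities and a telescoping of the level gaps); no limits here.
-/

noncomputable section

namespace Summit.AtomisticToContinuum.Crystallization.Theorems.PeriodicWindowsSketch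

open Literature.MathematicalPhysics.StatisticalMechanics Filter Metric

/-! ## Level heights -/

/-- Level heights with consecutive gaps `≥ 19/25` grow by at least `19/25` from any level to any
strictly higher one. -/
theorem gl_level_gap (c : ℤ → ℝ) (hc : ∀ m : ℤ, c m + 19 / 25 ≤ c (m + 1)) {m₁ m₂ : ℤ}
    (h : m₁ < m₂) : c m₁ + 19 / 25 ≤ c m₂ := by
  have hmono : Monotone fun m : ℤ => c m - 19 / 25 * (m : ℝ) :=
    monotone_int_of_le_succ fun m => by
      have := hc m
      simp only [Int.cast_add, Int.cast_one]
      linarith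
  have h12 : (m₁ : ℝ) + 1 ≤ (m₂ : ℝ) := by exact_mod_cast h
  have := hmono h.le
  simp only at this
  nlinarith

/-- Distinct levels have heights at least `19/25` apart. -/
theorem gl_level_gap_abs (c : ℤ → ℝ) (hc : ∀ m : ℤ, c m + 19 / 25 ≤ c (m + 1)) {m₁ m₂ : ℤ}
    (h : m₁ ≠ m₂) : 19 / 25 ≤ |c m₁ - c m₂| := by
  rcases lt_or_gt_of_ne h with h | h
  · have := gl_level_gap c hc h
    rw [abs_of_nonpos (by linarith)]
    linarith
  · have := gl_level_gap c hc h
    rw [abs_of_nonneg (by linarith)]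
    linarith

/-! ## Offsets along the normal of two window particles -/

/-- Along the normal, two window particles differ by the difference of their level heights up to
`2η` (flatness at both particles). -/
theorem gl_inner_sub_levels {N : ℕ} {y : Fin N → EuclideanSpace ℝ (Fin 3)} {i₀ : Fin N} {R η : ℝ}
    {nrm : EuclideanSpace ℝ (Fin 3)} {c : ℤ → ℝ} {l : Fin N → ℤ}
    (hflat : ∀ j, dist (y j) (y i₀) ≤ R → |inner ℝ (y j - y i₀) nrm - c (l j)| ≤ η)
    {j j' : Fin N} (hj : dist (y j) (y i₀) ≤ R) (hj' : dist (y j') (y i₀) ≤ R) :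
    |inner ℝ (y j' - y j) nrm - (c (l j') - c (l j))| ≤ 2 * η := by
  have h1 := abs_le.1 (hflat j hj)
  have h2 := abs_le.1 (hflat j' hj')
  have hid : inner ℝ (y j' - y j) nrm = inner ℝ (y j' - y i₀) nrm - inner ℝ (y j - y i₀) nrm := by
    rw [← inner_sub_left]
    congr 1
    abel
  rw [hid, abs_le]
  constructor <;> linarith

/-- Same level: `2η`-close along the normal; different levels: at least `19/25 - 2η` apart along
the normal. -/
theorem gl_levels_dichotomy {N : ℕ} {y : Fin N → EuclideanSpace ℝ (Fin 3)} {i₀ : Fin N} {R η : ℝ}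
    {nrm : EuclideanSpace ℝ (Fin 3)} {c : ℤ → ℝ} {l : Fin N → ℤ}
    (hc : ∀ m : ℤ, c m + 19 / 25 ≤ c (m + 1))
    (hflat : ∀ j, dist (y j) (y i₀) ≤ R → |inner ℝ (y j - y i₀) nrm - c (l j)| ≤ η)
    {j j' : Fin N} (hj : dist (y j) (y i₀) ≤ R) (hj' : dist (y j') (y i₀) ≤ R) :
    (l j' = l j → |inner ℝ (y j' - y j) nrm| ≤ 2 * η) ∧
      (l j' ≠ l j → 19 / 25 - 2 * η ≤ |inner ℝ (y j' - y j) nrm|) := by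
  have h := gl_inner_sub_levels hflat hj hj'
  constructor
  · intro hl
    rw [hl, sub_self, sub_zero] at h
    exact h
  · intro hl
    have hg := gl_level_gap_abs c hc hl
    have h3 := abs_sub_abs_le_abs_sub (c (l j') - c (l j)) (inner ℝ (y j' - y j) nrm)
    rw [abs_sub_comm (c (l j') - c (l j)) (inner ℝ (y j' - y j) nrm)] at h3
    linarith

/-- The dichotomy as a disjunction: two window particles are either `2η`-close or at least
`19/25 - 2η` apart along the normal. -/
theorem gl_levels_dichotomy_or {N : ℕ} {y : Fin N → EuclideanSpace ℝ (Fin 3)} {i₀ : Fin N} {R η : ℝ}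
    {nrm : EuclideanSpace ℝ (Fin 3)} {c : ℤ → ℝ} {l : Fin N → ℤ}
    (hc : ∀ m : ℤ, c m + 19 / 25 ≤ c (m + 1))
    (hflat : ∀ j, dist (y j) (y i₀) ≤ R → |inner ℝ (y j - y i₀) nrm - c (l j)| ≤ η)
    {j j' : Fin N} (hj : dist (y j) (y i₀) ≤ R) (hj' : dist (y j') (y i₀) ≤ R) :
    |inner ℝ (y j' - y j) nrm| ≤ 2 * η ∨ 19 / 25 - 2 * η ≤ |inner ℝ (y j' - y j) nrm| := by
  have h := gl_levels_dichotomy hc hflat hj hj'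
  by_cases hl : l j' = l j
  · exact Or.inl (h.1 hl)
  · exact Or.inr (h.2 hl)

/-! ## Sharp bonds -/

/-- A neighbour (distance `≤ 1`) of a half-window particle closer than `19/25 - 2η` along the
normal lies on the same level, so the bond length is `η`-close to `a`. -/
theorem gl_sharp_of_inner_lt {N : ℕ} {y : Fin N → EuclideanSpace ℝ (Fin 3)} {i₀ : Fin N}
    {R η a b : ℝ} {nrm : EuclideanSpace ℝ (Fin 3)} {c : ℤ → ℝ} {l : Fin N → ℤ}
    (hc : ∀ m : ℤ, c m + 19 / 25 ≤ c (m + 1))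
    (hflat : ∀ j, dist (y j) (y i₀) ≤ R → |inner ℝ (y j - y i₀) nrm - c (l j)| ≤ η)
    (hnbr : ∀ j : Fin N, dist (y j) (y i₀) ≤ R / 2 →
      Nat.card {j' : Fin N // j' ≠ j ∧ l j' = l j ∧ dist (y j) (y j') ≤ 1} = 6 ∧
      Nat.card {j' : Fin N // l j' = l j + 1 ∧ dist (y j) (y j') ≤ 1} = 3 ∧
      Nat.card {j' : Fin N // l j' = l j - 1 ∧ dist (y j) (y j') ≤ 1} = 3 ∧
      ∀ j' : Fin N, j' ≠ j → dist (y j) (y j') ≤ 1 →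
        (l j' = l j → |dist (y j) (y j') - a| ≤ η) ∧ (l j' ≠ l j → |dist (y j) (y j') - b| ≤ η))
    (hR : 0 ≤ R) {j j' : Fin N} (hj : dist (y j) (y i₀) ≤ R / 2) (hj' : dist (y j') (y i₀) ≤ R)
    (hne : j' ≠ j) (hd : dist (y j) (y j') ≤ 1)
    (hlt : |inner ℝ (y j' - y j) nrm| < 19 / 25 - 2 * η) : |dist (y j) (y j') - a| ≤ η := by
  have hjR : dist (y j) (y i₀) ≤ R := hj.trans (half_le_self hR)
  have hl : l j' = l j := by
    by_contra h
    have := (gl_levels_dichotomy hc hflat hjR hj').2 h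
    linarith
  exact ((hnbr j hj).2.2.2 j' hne hd).1 hl

/-! ## The neighbour families -/

/-- A subtype of `Fin N` of cardinality `K` is enumerated by an injective `Fin K → Fin N`. -/
theorem gl_exists_injective_of_card {N K : ℕ} (P : Fin N → Prop) (h : Nat.card {j // P j} = K) :
    ∃ g : Fin K → Fin N, Function.Injective g ∧ ∀ i, P (g i) := by
  have e : {j // P j} ≃ Fin K := (Finite.equivFin _).trans (finCongr h)
  exact ⟨fun i => (e.symm i).1, Subtype.val_injective.comp e.symm.injective, fun i => (e.symm i).2⟩

/-- A neighbour (distance `≤ 1`) of a half-window particle is a window particle (`R ≥ 2`). -/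
theorem gl_dist_centre_le_of_neighbour {N : ℕ} {y : Fin N → EuclideanSpace ℝ (Fin 3)} {i₀ : Fin N}
    {R : ℝ} (hR : 2 ≤ R) {J j : Fin N} (hJ : dist (y J) (y i₀) ≤ R / 2)
    (hd : dist (y J) (y j) ≤ 1) :
    dist (y j) (y i₀) ≤ R :=
  calc dist (y j) (y i₀) ≤ dist (y J) (y j) + dist (y J) (y i₀) := dist_triangle_left _ _ _
    _ ≤ 1 + R / 2 := add_le_add hd hJ
    _ ≤ R := by linarith

/-- The six same-level neighbours of a half-window particle `J`, in the unified shape: an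
injective family of six window particles `≠ J` within distance `1` of `J`, bonds `η`-close to
`a`, offsets along the normal `2η`-close to `0 * G` (`G = 1`). -/
theorem gl_six_indices {N : ℕ} {y : Fin N → EuclideanSpace ℝ (Fin 3)} {i₀ : Fin N} {R η a b : ℝ}
    {nrm : EuclideanSpace ℝ (Fin 3)} {c : ℤ → ℝ} {l : Fin N → ℤ}
    (hc : ∀ m : ℤ, c m + 19 / 25 ≤ c (m + 1))
    (hflat : ∀ j, dist (y j) (y i₀) ≤ R → |inner ℝ (y j - y i₀) nrm - c (l j)| ≤ η)
    (hnbr : ∀ j : Fin N, dist (y j) (y i₀) ≤ R / 2 →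
      Nat.card {j' : Fin N // j' ≠ j ∧ l j' = l j ∧ dist (y j) (y j') ≤ 1} = 6 ∧
      Nat.card {j' : Fin N // l j' = l j + 1 ∧ dist (y j) (y j') ≤ 1} = 3 ∧
      Nat.card {j' : Fin N // l j' = l j - 1 ∧ dist (y j) (y j') ≤ 1} = 3 ∧
      ∀ j' : Fin N, j' ≠ j → dist (y j) (y j') ≤ 1 →
        (l j' = l j → |dist (y j) (y j') - a| ≤ η) ∧ (l j' ≠ l j → |dist (y j) (y j') - b| ≤ η))
    (hR : 2 ≤ R) {J : Fin N} (hJ : dist (y J) (y i₀) ≤ R / 2) :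
    ∃ g : Fin 6 → Fin N, Function.Injective g ∧ ∃ G : ℝ, 19 / 25 ≤ G ∧ ∀ i, g i ≠ J ∧
      dist (y (g i)) (y i₀) ≤ R ∧ dist (y J) (y (g i)) ≤ 1 ∧ |dist (y J) (y (g i)) - a| ≤ η ∧
      |inner ℝ (y (g i) - y J) nrm - 0 * G| ≤ 2 * η := by
  obtain ⟨h6, -, -, hsh⟩ := hnbr J hJ
  obtain ⟨g, hg, hP⟩ := gl_exists_injective_of_card _ h6
  have hJR : dist (y J) (y i₀) ≤ R := hJ.trans (half_le_self (by linarith))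
  refine ⟨g, hg, 1, by norm_num, fun i => ?_⟩
  obtain ⟨hne, hl, hd⟩ := hP i
  have hiR : dist (y (g i)) (y i₀) ≤ R := gl_dist_centre_le_of_neighbour hR hJ hd
  refine ⟨hne, hiR, hd, (hsh (g i) hne hd).1 hl, ?_⟩
  rw [zero_mul, sub_zero]
  exact (gl_levels_dichotomy hc hflat hJR hiR).1 hl

/-- The three upper neighbours of a half-window particle `J`, in the unified shape: an injective
family of three window particles `≠ J` within distance `1` of `J`, bonds `η`-close to `b`, offsets
along the normal `2η`-close to `1 * G` with `G = c (l J + 1) - c (l J) ≥ 19/25`. -/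
theorem gl_up_indices {N : ℕ} {y : Fin N → EuclideanSpace ℝ (Fin 3)} {i₀ : Fin N} {R η a b : ℝ}
    {nrm : EuclideanSpace ℝ (Fin 3)} {c : ℤ → ℝ} {l : Fin N → ℤ}
    (hc : ∀ m : ℤ, c m + 19 / 25 ≤ c (m + 1))
    (hflat : ∀ j, dist (y j) (y i₀) ≤ R → |inner ℝ (y j - y i₀) nrm - c (l j)| ≤ η)
    (hnbr : ∀ j : Fin N, dist (y j) (y i₀) ≤ R / 2 →
      Nat.card {j' : Fin N // j' ≠ j ∧ l j' = l j ∧ dist (y j) (y j') ≤ 1} = 6 ∧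
      Nat.card {j' : Fin N // l j' = l j + 1 ∧ dist (y j) (y j') ≤ 1} = 3 ∧
      Nat.card {j' : Fin N // l j' = l j - 1 ∧ dist (y j) (y j') ≤ 1} = 3 ∧
      ∀ j' : Fin N, j' ≠ j → dist (y j) (y j') ≤ 1 →
        (l j' = l j → |dist (y j) (y j') - a| ≤ η) ∧ (l j' ≠ l j → |dist (y j) (y j') - b| ≤ η))
    (hR : 2 ≤ R) {J : Fin N} (hJ : dist (y J) (y i₀) ≤ R / 2) :
    ∃ g : Fin 3 → Fin N, Function.Injective g ∧ ∃ G : ℝ, 19 / 25 ≤ G ∧ ∀ i, g i ≠ J ∧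
      dist (y (g i)) (y i₀) ≤ R ∧ dist (y J) (y (g i)) ≤ 1 ∧ |dist (y J) (y (g i)) - b| ≤ η ∧
      |inner ℝ (y (g i) - y J) nrm - 1 * G| ≤ 2 * η := by
  obtain ⟨-, h3, -, hsh⟩ := hnbr J hJ
  obtain ⟨g, hg, hP⟩ := gl_exists_injective_of_card _ h3
  have hJR : dist (y J) (y i₀) ≤ R := hJ.trans (half_le_self (by linarith))
  refine ⟨g, hg, c (l J + 1) - c (l J), by linarith [hc (l J)], fun i => ?_⟩
  obtain ⟨hl, hd⟩ := hP i
  have hlne : l (g i) ≠ l J := by rw [hl]; simp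
  have hne : g i ≠ J := fun h => hlne (by rw [h])
  have hiR : dist (y (g i)) (y i₀) ≤ R := gl_dist_centre_le_of_neighbour hR hJ hd
  refine ⟨hne, hiR, hd, (hsh (g i) hne hd).2 hlne, ?_⟩
  have h := gl_inner_sub_levels hflat hJR hiR
  rw [hl] at h
  rwa [one_mul]

/-- The three lower neighbours of a half-window particle `J`, in the unified shape: an injective
family of three window particles `≠ J` within distance `1` of `J`, bonds `η`-close to `b`, offsets
along the normal `2η`-close to `(-1) * G` with `G = c (l J) - c (l J - 1) ≥ 19/25`. -/
theorem gl_down_indices {N : ℕ} {y : Fin N → EuclideanSpace ℝ (Fin 3)} {i₀ : Fin N} {R η a b : ℝ}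
    {nrm : EuclideanSpace ℝ (Fin 3)} {c : ℤ → ℝ} {l : Fin N → ℤ}
    (hc : ∀ m : ℤ, c m + 19 / 25 ≤ c (m + 1))
    (hflat : ∀ j, dist (y j) (y i₀) ≤ R → |inner ℝ (y j - y i₀) nrm - c (l j)| ≤ η)
    (hnbr : ∀ j : Fin N, dist (y j) (y i₀) ≤ R / 2 →
      Nat.card {j' : Fin N // j' ≠ j ∧ l j' = l j ∧ dist (y j) (y j') ≤ 1} = 6 ∧
      Nat.card {j' : Fin N // l j' = l j + 1 ∧ dist (y j) (y j') ≤ 1} = 3 ∧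
      Nat.card {j' : Fin N // l j' = l j - 1 ∧ dist (y j) (y j') ≤ 1} = 3 ∧
      ∀ j' : Fin N, j' ≠ j → dist (y j) (y j') ≤ 1 →
        (l j' = l j → |dist (y j) (y j') - a| ≤ η) ∧ (l j' ≠ l j → |dist (y j) (y j') - b| ≤ η))
    (hR : 2 ≤ R) {J : Fin N} (hJ : dist (y J) (y i₀) ≤ R / 2) :
    ∃ g : Fin 3 → Fin N, Function.Injective g ∧ ∃ G : ℝ, 19 / 25 ≤ G ∧ ∀ i, g i ≠ J ∧
      dist (y (g i)) (y i₀) ≤ R ∧ dist (y J) (y (g i)) ≤ 1 ∧ |dist (y J) (y (g i)) - b| ≤ η ∧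
      |inner ℝ (y (g i) - y J) nrm - (-1) * G| ≤ 2 * η := by
  obtain ⟨-, -, h3, hsh⟩ := hnbr J hJ
  obtain ⟨g, hg, hP⟩ := gl_exists_injective_of_card _ h3
  have hJR : dist (y J) (y i₀) ≤ R := hJ.trans (half_le_self (by linarith))
  have hG : 19 / 25 ≤ c (l J) - c (l J - 1) := by
    have := hc (l J - 1)
    rw [sub_add_cancel] at this
    linarith
  refine ⟨g, hg, c (l J) - c (l J - 1), hG, fun i => ?_⟩
  obtain ⟨hl, hd⟩ := hP i
  have hlne : l (g i) ≠ l J := by rw [hl]; simp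
  have hne : g i ≠ J := fun h => hlne (by rw [h])
  have hiR : dist (y (g i)) (y i₀) ≤ R := gl_dist_centre_le_of_neighbour hR hJ hd
  refine ⟨hne, hiR, hd, (hsh (g i) hne hd).2 hlne, ?_⟩
  have h := gl_inner_sub_levels hflat hJR hiR
  rw [hl] at h
  have hid : c (l J - 1) - c (l J) = (-1) * (c (l J) - c (l J - 1)) := by ring
  rwa [hid] at h

end Summit.AtomisticToContinuum.Crystallization.Theorems.PeriodicWindowsSketch

end
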